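import Summits.BirchSwinnertonDyer.BirchSwinnertonDyer.Theorems.ByReductionTypeAtTwoSupersingularFlatBlindCardGlue
import Summits.BirchSwinnertonDyer.BirchSwinnertonDyer.Theorems.ByReductionTypeAtTwoSupersingularFlatBlindCardIndex
import Summits.BirchSwinnertonDyer.BirchSwinnertonDyer.Theorems.ByReductionTypeAtTwoSupersingularFlatBlindCardTransport
import Summits.BirchSwinnertonDyer.BirchSwinnertonDyer.Theorems.ByReductionTypeAtTwoSupersingularFlatBlindTwistCurveSide
import Summits.BirchSwinnertonDyer.BirchSwinnertonDyer.Theorems.ByReductionTypeAtTwoSupersingularFlatBlindTwistSideStrictCount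
import Summits.BirchSwinnertonDyer.BirchSwinnertonDyer.Theorems.ByReductionTypeAtTwoSupersingularFlatBlindTwistSideKummerLine
import Summits.BirchSwinnertonDyer.Rank1Residual.F1Sign2.HondaSystemAtTwo
import Literature.NumberTheory.EllipticCurves.PadicFormalLogOrder
import Literature.NumberTheory.EllipticCurves.TamagawaFiniteIndexProofs
import HarnessLib

/-!
# Route `ByReductionTypeAtTwo` (rung K4), crux `SupersingularRankZeroAtTwo` (item stmt-BirchSwinnertonDyer-19097), line `odd_blind_package`
# slot 5 `stub_CD` = CDC_H: **THE CDC_H GLUE WITH THREE BINDERS** — (B5) fed BY NAME (★ `valuation_sub_padicValNat_index_eq_of_generator`)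
# (cell `bsd-2adic`, LEAD ss-1 GEN 21; memo `HOME/ss/gen21/HAND-TARGETS-CDC-3.md`)

HONEST FRAMING: THEOREMS ONLY (no definition, no named fact, no `sorry`, no instance); a helper (`--supports stmt-BirchSwinnertonDyer-19097`).
It REDUCES CDC_H (`OddBlindPackage.FlatBlindControlCardHondaAtTwo`, body VERBATIM as the conclusion) to the THREE W₂-side binders
(B1) twist dictionary, (B2) Tamagawa splitting count, (B3) position count — the binder (B5) of ★★ p814705 `flatBlindControlCardHondaAtTwo_of`
being now the tree theorem `valuation_sub_padicValNat_index_eq_of_generator`. Nothing booked; 19097 stays OPEN; BSD is proved for no curve.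
bears_on: K4 (19097).
-/

set_option autoImplicit false
set_option linter.dupNamespace false

noncomputable section

open scoped Classical NumberField AddSubgroup ContRepresentation

namespace Summit.BirchSwinnertonDyer.BirchSwinnertonDyer.Theorems

namespace OddBlindLocal

open NumberField IsDedekindDomain Field WeierstrassCurve Literature.NumberTheory.EllipticCurves
  Literature.NumberTheory.EllipticCurves.IwasawaDual Literature.NumberTheory.GaloisRepresentations
  Literature.NumberTheory.GaloisCohomology ZpExtension Literature.NumberTheory.EllipticCurves.Kobayashi2003
  Literature.NumberTheory.EllipticCurves.Sprung2017 Literature.NumberTheory.EllipticCurves.Sprung2012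
  Literature.NumberTheory.EllipticCurves.Rank1Residual Summit.BirchSwinnertonDyer.Rank1Residual.Additive
open Literature.NumberTheory.GaloisRepresentations.DiscreteGaloisModule (SelmerStructure)

/-- ★★ **THE CDC_H GLUE WITH THREE BINDERS**: `OddBlindPackage.FlatBlindControlCardHondaAtTwo` (body VERBATIM) from (B1) the twist dictionary,
(B2) the Tamagawa splitting count and (B3) the position count — the index bookkeeping (B5) of `flatBlindControlCardHondaAtTwo_of` (★★ p814705) fed BY NAME
(`valuation_sub_padicValNat_index_eq_of_generator`). The remaining debt toward CDC_H is exactly (B1) (B2) (B3) (the provers of (B2)/(B3) carry the print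
binder `poitouTate_selmerStructure_duality_real ℚ`, Milne ADT I.4.10). HONEST: a reduction; 19097 stays OPEN; BSD is proved for no curve.
[cite: GreenbergLNM1716, §3 Lemma 3.3 and §4 pp. 122–124] [cite: MilneADT2006, I Thm. 4.10] [cite: Sprung2012, Def. 7.9, Def. 7.11, Thm. 2.2] -/
theorem flatBlindControlCardHondaAtTwo_of_dictionary_of_tamagawa_of_position
    (hB1 : ∀ (W : WeierstrassCurve ℚ) [W.IsElliptic] [W.IsGloballyMinimal], GoodSS W 2 →
      ∀ (κ : ZpExtension ℚ 2), κ.IsCyclotomic →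
      ∀ (v : HeightOneSpectrum (𝓞 ℚ)), (2 : 𝓞 ℚ) ∈ v.asIdeal →
      ∀ (g : Field.absoluteGaloisGroup (v.adicCompletion ℚ)) (c : ℕ → localPoints W (v.adicCompletion ℚ)),
        κ.IsTopGenerator (resGalOfEmb (closureEmb (K := ℚ) (v.adicCompletion ℚ)) g) →
      ∀ (W₂ : WeierstrassCurve ℚ) [W₂.IsElliptic] [W₂.IsGloballyMinimal],
        (∃ C : WeierstrassCurve.VariableChange ℚ, C • W.quadraticTwist 2 = W₂) →
      ∀ J : ℕ, ∃ (φ : (W₂.torsionGaloisModule ((2 ^ J : ℕ) : ℤ)).toContRepresentation →ⁱL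
          (W.twistedTorsionGaloisModule 2 κ J (-1) OddBlindTwist.two_dvd_neg_one_sub_one).toContRepresentation)
        (ψ : (W.twistedTorsionGaloisModule 2 κ J (-1) OddBlindTwist.two_dvd_neg_one_sub_one).toContRepresentation →ⁱL
          (W₂.torsionGaloisModule ((2 ^ J : ℕ) : ℤ)).toContRepresentation),
        (∀ a, ψ (φ a) = a) ∧ (∀ b, φ (ψ b) = b) ∧
        (∀ w : InfinitePlace ℚ, ((W.twistedTorsionToLocalH1 2 κ J (-1) OddBlindTwist.two_dvd_neg_one_sub_one w.Completion).ker).map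
            (galoisCohomology.map (ψ.restrictField w.Completion) 1) =
          W₂.kummerLocalConditionAt ((2 ^ J : ℕ) : ℤ) w.Completion) ∧
        (∀ v' : HeightOneSpectrum (𝓞 ℚ), v' ≠ v →
          (W.twistedSharpFlatLocalFamily 2 κ J (-1) OddBlindTwist.two_dvd_neg_one_sub_one v
              (localTowerPointsOfEmb κ (closureEmb (K := ℚ) (v.adicCompletion ℚ)) W)
              (colemanKer κ (closureEmb (K := ℚ) (v.adicCompletion ℚ)) W (W.frobeniusTrace 2) g c .flat) v').map
            (galoisCohomology.map (ψ.restrictField (v'.adicCompletion ℚ)) 1) =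
          ((resH1Hom (Literature.NumberTheory.EllipticCurves.subgroupIncl (localSubgroup κ.kerSubgroup (v'.adicCompletion ℚ)))
              (AddMonoidHom.id (localPoints W₂ (v'.adicCompletion ℚ))) (fun _ _ ↦ rfl)).ker).comap
            (galoisCohomology.map (W₂.torsionPointsMapIntertwining ((2 ^ J : ℕ) : ℤ) (v'.adicCompletion ℚ)) 1)) ∧
        (W₂.kummerLocalConditionAt ((2 ^ J : ℕ) : ℤ) (v.adicCompletion ℚ)).map
            (galoisCohomology.map (φ.restrictField (v.adicCompletion ℚ)) 1) ≤
          W.twistedTorsionLocalKummer 2 κ J (-1) OddBlindTwist.two_dvd_neg_one_sub_one (v.adicCompletion ℚ)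
            (localLayerPointsOfEmb κ (closureEmb (K := ℚ) (v.adicCompletion ℚ)) W 1 ⊓
              (DistribSMul.toAddMonoidHom (localPoints W (v.adicCompletion ℚ)) g + AddMonoidHom.id _).ker))
    (hB2 : ∀ (W : WeierstrassCurve ℚ) [W.IsElliptic] [W.IsGloballyMinimal], GoodSS W 2 →
      ∀ (κ : ZpExtension ℚ 2) (γ : Field.absoluteGaloisGroup ℚ), κ.IsCyclotomic → κ.IsTopGenerator γ →
      ∀ (v : HeightOneSpectrum (𝓞 ℚ)), (2 : 𝓞 ℚ) ∈ v.asIdeal →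
      ∀ (g : Field.absoluteGaloisGroup (v.adicCompletion ℚ)) (c : ℕ → localPoints W (v.adicCompletion ℚ)),
        κ.IsTopGenerator (resGalOfEmb (closureEmb (K := ℚ) (v.adicCompletion ℚ)) g) →
      ∀ (W₂ : WeierstrassCurve ℚ) [W₂.IsElliptic] [W₂.IsGloballyMinimal],
        (∃ C : WeierstrassCurve.VariableChange ℚ, C • W.quadraticTwist 2 = W₂) →
        Finite (endInvariants (conjSharpFlatSelmerInfty W κ (closureEmb (K := ℚ) (v.adicCompletion ℚ))
          (W.frobeniusTrace 2) g c .flat γ + 1)) →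
      ∃ J₁ : ℕ, ∀ J : ℕ, J₁ ≤ J →
      ∀ (φ : (W₂.torsionGaloisModule ((2 ^ J : ℕ) : ℤ)).toContRepresentation →ⁱL
          (W.twistedTorsionGaloisModule 2 κ J (-1) OddBlindTwist.two_dvd_neg_one_sub_one).toContRepresentation)
        (ψ : (W.twistedTorsionGaloisModule 2 κ J (-1) OddBlindTwist.two_dvd_neg_one_sub_one).toContRepresentation →ⁱL
          (W₂.torsionGaloisModule ((2 ^ J : ℕ) : ℤ)).toContRepresentation),
        (∀ a, ψ (φ a) = a) → (∀ b, φ (ψ b) = b) →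
        (∀ w : InfinitePlace ℚ, ((W.twistedTorsionToLocalH1 2 κ J (-1) OddBlindTwist.two_dvd_neg_one_sub_one w.Completion).ker).map
            (galoisCohomology.map (ψ.restrictField w.Completion) 1) =
          W₂.kummerLocalConditionAt ((2 ^ J : ℕ) : ℤ) w.Completion) →
        (∀ v' : HeightOneSpectrum (𝓞 ℚ), v' ≠ v →
          (W.twistedSharpFlatLocalFamily 2 κ J (-1) OddBlindTwist.two_dvd_neg_one_sub_one v
              (localTowerPointsOfEmb κ (closureEmb (K := ℚ) (v.adicCompletion ℚ)) W)
              (colemanKer κ (closureEmb (K := ℚ) (v.adicCompletion ℚ)) W (W.frobeniusTrace 2) g c .flat) v').map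
            (galoisCohomology.map (ψ.restrictField (v'.adicCompletion ℚ)) 1) =
          ((resH1Hom (Literature.NumberTheory.EllipticCurves.subgroupIncl (localSubgroup κ.kerSubgroup (v'.adicCompletion ℚ)))
              (AddMonoidHom.id (localPoints W₂ (v'.adicCompletion ℚ))) (fun _ _ ↦ rfl)).ker).comap
            (galoisCohomology.map (W₂.torsionPointsMapIntertwining ((2 ^ J : ℕ) : ℤ) (v'.adicCompletion ℚ)) 1)) →
        (W₂.kummerLocalConditionAt ((2 ^ J : ℕ) : ℤ) (v.adicCompletion ℚ)).map
            (galoisCohomology.map (φ.restrictField (v.adicCompletion ℚ)) 1) ≤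
          W.twistedTorsionLocalKummer 2 κ J (-1) OddBlindTwist.two_dvd_neg_one_sub_one (v.adicCompletion ℚ)
            (localLayerPointsOfEmb κ (closureEmb (K := ℚ) (v.adicCompletion ℚ)) W 1 ⊓
              (DistribSMul.toAddMonoidHom (localPoints W (v.adicCompletion ℚ)) g + AddMonoidHom.id _).ker) →
      ∀ (𝓑 𝓑' : SelmerStructure (W₂.torsionGaloisModule ((2 ^ J : ℕ) : ℤ))),
        (∀ w : InfinitePlace ℚ, 𝓑 (Sum.inl w) =
          ((W.twistedTorsionToLocalH1 2 κ J (-1) OddBlindTwist.two_dvd_neg_one_sub_one w.Completion).ker).map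
            (galoisCohomology.map (ψ.restrictField w.Completion) 1)) →
        (∀ v' : HeightOneSpectrum (𝓞 ℚ), 𝓑 (Sum.inr v') =
          (W.twistedSharpFlatLocalFamily 2 κ J (-1) OddBlindTwist.two_dvd_neg_one_sub_one v
            (localTowerPointsOfEmb κ (closureEmb (K := ℚ) (v.adicCompletion ℚ)) W)
            (colemanKer κ (closureEmb (K := ℚ) (v.adicCompletion ℚ)) W (W.frobeniusTrace 2) g c .flat) v').map
            (galoisCohomology.map (ψ.restrictField (v'.adicCompletion ℚ)) 1)) →
        (∀ w : InfinitePlace ℚ, 𝓑' (Sum.inl w) = W₂.kummerLocalConditionAt ((2 ^ J : ℕ) : ℤ) w.Completion) →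
        (𝓑' (Sum.inr v) = (W.twistedSharpFlatLocalFamily 2 κ J (-1) OddBlindTwist.two_dvd_neg_one_sub_one v
            (localTowerPointsOfEmb κ (closureEmb (K := ℚ) (v.adicCompletion ℚ)) W)
            (colemanKer κ (closureEmb (K := ℚ) (v.adicCompletion ℚ)) W (W.frobeniusTrace 2) g c .flat) v).map
            (galoisCohomology.map (ψ.restrictField (v.adicCompletion ℚ)) 1)) →
        (∀ v' : HeightOneSpectrum (𝓞 ℚ), v' ≠ v → 𝓑' (Sum.inr v') = W₂.kummerLocalConditionAt ((2 ^ J : ℕ) : ℤ) (v'.adicCompletion ℚ)) →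
        Nat.card 𝓑.selmerGroup *
            2 ^ padicValNat 2 ((W₂.baseChange (v.adicCompletion ℚ)).localTamagawaNumber (v.adicCompletionIntegers ℚ)) =
          Nat.card 𝓑'.selmerGroup * 2 ^ padicValNat 2 W₂.tamagawaProduct)
    (hB3 : ∀ (W : WeierstrassCurve ℚ) [W.IsElliptic] [W.IsGloballyMinimal], GoodSS W 2 →
      ∀ (κ : ZpExtension ℚ 2) (γ : Field.absoluteGaloisGroup ℚ), κ.IsCyclotomic → κ.IsTopGenerator γ →
      ∀ (v : HeightOneSpectrum (𝓞 ℚ)), (2 : 𝓞 ℚ) ∈ v.asIdeal →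
      ∀ (g : Field.absoluteGaloisGroup (v.adicCompletion ℚ)) (c : ℕ → localPoints W (v.adicCompletion ℚ)),
        κ.IsTopGenerator (resGalOfEmb (closureEmb (K := ℚ) (v.adicCompletion ℚ)) g) →
        (∀ n, c n ∈ localLayerPointsOfEmb κ (closureEmb (K := ℚ) (v.adicCompletion ℚ)) W n) →
        (∀ n, 1 ≤ n → localTraceOfEmb κ (closureEmb (K := ℚ) (v.adicCompletion ℚ)) W n (n + 1)
          (c (n + 1)) = W.frobeniusTrace 2 • c n - c (n - 1)) →
        (∀ z₀ : localLayerPointsOfEmb κ (closureEmb (K := ℚ) (v.adicCompletion ℚ)) W 0 →+ ℤ_[2],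
          evalOn W (localLayerPointsOfEmb κ (closureEmb (K := ℚ) (v.adicCompletion ℚ)) W 0) z₀ (c 0) = 0 → z₀ = 0) →
        (∀ a : ℤ_[2],
          (∃ z₀ : localLayerPointsOfEmb κ (closureEmb (K := ℚ) (v.adicCompletion ℚ)) W 0 →+ ℤ_[2],
            evalOn W (localLayerPointsOfEmb κ (closureEmb (K := ℚ) (v.adicCompletion ℚ)) W 0) z₀ (c 0) = 2 * a) →
          ∃ y : localLayerPointsOfEmb κ (closureEmb (K := ℚ) (v.adicCompletion ℚ)) W 0 →+ ℤ_[2],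
            evalOn W (localLayerPointsOfEmb κ (closureEmb (K := ℚ) (v.adicCompletion ℚ)) W 0) y (c 0) = a) →
        (∃ cneg : localPoints W (v.adicCompletion ℚ),
          Summit.BirchSwinnertonDyer.Rank1Residual.F1Sign2.IsHondaSystemAtTwo κ (closureEmb (K := ℚ) (v.adicCompletion ℚ)) W
            (W.frobeniusTrace 2) g cneg c) →
      ∀ (W₂ : WeierstrassCurve ℚ) [W₂.IsElliptic] [W₂.IsGloballyMinimal],
        (∃ C : WeierstrassCurve.VariableChange ℚ, C • W.quadraticTwist 2 = W₂) →
        W₂.mordellWeilRank = 1 → Finite (AddCommGroup.primaryComponent W₂.sha 2) →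
        Finite (endInvariants (conjSharpFlatSelmerInfty W κ (closureEmb (K := ℚ) (v.adicCompletion ℚ))
          (W.frobeniusTrace 2) g c .flat γ + 1)) →
      ∃ J₂ : ℕ, ∀ J : ℕ, J₂ ≤ J →
      ∀ (φ : (W₂.torsionGaloisModule ((2 ^ J : ℕ) : ℤ)).toContRepresentation →ⁱL
          (W.twistedTorsionGaloisModule 2 κ J (-1) OddBlindTwist.two_dvd_neg_one_sub_one).toContRepresentation)
        (ψ : (W.twistedTorsionGaloisModule 2 κ J (-1) OddBlindTwist.two_dvd_neg_one_sub_one).toContRepresentation →ⁱL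
          (W₂.torsionGaloisModule ((2 ^ J : ℕ) : ℤ)).toContRepresentation),
        (∀ a, ψ (φ a) = a) → (∀ b, φ (ψ b) = b) →
        (∀ w : InfinitePlace ℚ, ((W.twistedTorsionToLocalH1 2 κ J (-1) OddBlindTwist.two_dvd_neg_one_sub_one w.Completion).ker).map
            (galoisCohomology.map (ψ.restrictField w.Completion) 1) =
          W₂.kummerLocalConditionAt ((2 ^ J : ℕ) : ℤ) w.Completion) →
        (∀ v' : HeightOneSpectrum (𝓞 ℚ), v' ≠ v →
          (W.twistedSharpFlatLocalFamily 2 κ J (-1) OddBlindTwist.two_dvd_neg_one_sub_one v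
              (localTowerPointsOfEmb κ (closureEmb (K := ℚ) (v.adicCompletion ℚ)) W)
              (colemanKer κ (closureEmb (K := ℚ) (v.adicCompletion ℚ)) W (W.frobeniusTrace 2) g c .flat) v').map
            (galoisCohomology.map (ψ.restrictField (v'.adicCompletion ℚ)) 1) =
          ((resH1Hom (Literature.NumberTheory.EllipticCurves.subgroupIncl (localSubgroup κ.kerSubgroup (v'.adicCompletion ℚ)))
              (AddMonoidHom.id (localPoints W₂ (v'.adicCompletion ℚ))) (fun _ _ ↦ rfl)).ker).comap
            (galoisCohomology.map (W₂.torsionPointsMapIntertwining ((2 ^ J : ℕ) : ℤ) (v'.adicCompletion ℚ)) 1)) →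
        (W₂.kummerLocalConditionAt ((2 ^ J : ℕ) : ℤ) (v.adicCompletion ℚ)).map
            (galoisCohomology.map (φ.restrictField (v.adicCompletion ℚ)) 1) ≤
          W.twistedTorsionLocalKummer 2 κ J (-1) OddBlindTwist.two_dvd_neg_one_sub_one (v.adicCompletion ℚ)
            (localLayerPointsOfEmb κ (closureEmb (K := ℚ) (v.adicCompletion ℚ)) W 1 ⊓
              (DistribSMul.toAddMonoidHom (localPoints W (v.adicCompletion ℚ)) g + AddMonoidHom.id _).ker) →
      ∀ (𝓑' : SelmerStructure (W₂.torsionGaloisModule ((2 ^ J : ℕ) : ℤ))),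
        (∀ w : InfinitePlace ℚ, 𝓑' (Sum.inl w) = W₂.kummerLocalConditionAt ((2 ^ J : ℕ) : ℤ) w.Completion) →
        (𝓑' (Sum.inr v) = (W.twistedSharpFlatLocalFamily 2 κ J (-1) OddBlindTwist.two_dvd_neg_one_sub_one v
            (localTowerPointsOfEmb κ (closureEmb (K := ℚ) (v.adicCompletion ℚ)) W)
            (colemanKer κ (closureEmb (K := ℚ) (v.adicCompletion ℚ)) W (W.frobeniusTrace 2) g c .flat) v).map
            (galoisCohomology.map (ψ.restrictField (v.adicCompletion ℚ)) 1)) →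
        (∀ v' : HeightOneSpectrum (𝓞 ℚ), v' ≠ v → 𝓑' (Sum.inr v') = W₂.kummerLocalConditionAt ((2 ^ J : ℕ) : ℤ) (v'.adicCompletion ℚ)) →
      ∀ (lam : (W₂.baseChange ℚ_[2]).toAffine.Point →+ ℤ_[2]), (∀ X, lam X = 0 ↔ IsOfFinAddOrder X) → Function.Surjective lam →
      ∀ (P₁ : W₂.toAffine.Point), (∀ P : W₂.toAffine.Point, ∃ (a : ℤ) (t : W₂.toAffine.Point), IsOfFinAddOrder t ∧ P = a • P₁ + t) →
        Nat.card 𝓑'.selmerGroup =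
          Nat.card ↥(W₂.selmerGroupPInfty 2 ⊓ selmerLocalKerPrimaryTorsion W₂ ℚ_[2] 2) *
            2 ^ (lam (Affine.Point.baseChange (W' := W₂) ℚ ℚ_[2] P₁)).valuation) :
    ∀ (W : WeierstrassCurve ℚ) [W.IsElliptic] [W.IsGloballyMinimal],
    ¬ W.HasCM → GoodSS W 2 → W.rootNumber * ZMod.χ₈ (W.conductorNorm ℤ : ZMod 8) = -1 →
    ∀ (κ : ZpExtension ℚ 2) (γ : Field.absoluteGaloisGroup ℚ),
      κ.IsCyclotomic → κ.IsTopGenerator γ → IsCyclotomicVariable 2 γ →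
    ∀ (v : HeightOneSpectrum (𝓞 ℚ)), (2 : 𝓞 ℚ) ∈ v.asIdeal →
    ∀ (g : Field.absoluteGaloisGroup (v.adicCompletion ℚ)) (c : ℕ → localPoints W (v.adicCompletion ℚ)),
      κ.IsTopGenerator (resGalOfEmb (closureEmb (K := ℚ) (v.adicCompletion ℚ)) g) →
      (∀ n, c n ∈ localLayerPointsOfEmb κ (closureEmb (K := ℚ) (v.adicCompletion ℚ)) W n) →
      (∀ n, 1 ≤ n → localTraceOfEmb κ (closureEmb (K := ℚ) (v.adicCompletion ℚ)) W n (n + 1)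
        (c (n + 1)) = W.frobeniusTrace 2 • c n - c (n - 1)) →
      (∀ z₀ : localLayerPointsOfEmb κ (closureEmb (K := ℚ) (v.adicCompletion ℚ)) W 0 →+ ℤ_[2],
        evalOn W (localLayerPointsOfEmb κ (closureEmb (K := ℚ) (v.adicCompletion ℚ)) W 0) z₀ (c 0) = 0 →
          z₀ = 0) →
      (∀ a : ℤ_[2],
        (∃ z₀ : localLayerPointsOfEmb κ (closureEmb (K := ℚ) (v.adicCompletion ℚ)) W 0 →+ ℤ_[2],
          evalOn W (localLayerPointsOfEmb κ (closureEmb (K := ℚ) (v.adicCompletion ℚ)) W 0) z₀ (c 0) = 2 * a) →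
        ∃ y : localLayerPointsOfEmb κ (closureEmb (K := ℚ) (v.adicCompletion ℚ)) W 0 →+ ℤ_[2],
          evalOn W (localLayerPointsOfEmb κ (closureEmb (K := ℚ) (v.adicCompletion ℚ)) W 0) y (c 0) = a) →
      (∃ cneg : localPoints W (v.adicCompletion ℚ),
        Summit.BirchSwinnertonDyer.Rank1Residual.F1Sign2.IsHondaSystemAtTwo κ (closureEmb (K := ℚ) (v.adicCompletion ℚ)) W
          (W.frobeniusTrace 2) g cneg c) →
    ∀ (W₂ : WeierstrassCurve ℚ) [W₂.IsElliptic] [W₂.IsGloballyMinimal],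
      (∃ C : WeierstrassCurve.VariableChange ℚ, C • W.quadraticTwist 2 = W₂) →
      W₂.mordellWeilRank = 1 → Finite (AddCommGroup.primaryComponent W₂.sha 2) →
    ∀ (ι : ℚ →+* ℚ_[2]) (P : (W₂.baseChange ℚ).toAffine.Point), ¬ IsOfFinAddOrder P →
      Finite (endInvariants (conjSharpFlatSelmerInfty W κ (closureEmb (K := ℚ) (v.adicCompletion ℚ))
        (W.frobeniusTrace 2) g c .flat γ + 1)) →
      (padicValNat 2 (Nat.card (endInvariants (conjSharpFlatSelmerInfty W κ
          (closureEmb (K := ℚ) (v.adicCompletion ℚ)) (W.frobeniusTrace 2) g c .flat γ + 1))) : ℤ) =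
        (padicValNat 2 (Nat.card (AddCommGroup.primaryComponent W₂.sha 2)) : ℤ) +
          (padicValNat 2 W₂.tamagawaProduct : ℤ) +
          2 * (Literature.NumberTheory.EllipticCurves.padicLogOrd W₂ 2 ι P -
            (padicValNat 2 (AddSubgroup.zmultiples P).index : ℤ)) :=
  flatBlindControlCardHondaAtTwo_of hB1 hB2 hB3 valuation_sub_padicValNat_index_eq_of_generator

end OddBlindLocal

end Summit.BirchSwinnertonDyer.BirchSwinnertonDyer.Theorems

end
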